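import Summits.SmoothPoincare4.SmoothPoincare4.Theses.CongruenceShadows
import Summits.SmoothPoincare4.SmoothPoincare4.Theorems.WaldhausenPairs.Negative.LoadBearing
import Summits.SmoothPoincare4.SmoothPoincare4.Theorems.CongruenceShadowsHeegaardHandlebodyCongruenceClosedLevelCollapse

/-!
# Stub P3 `stub_limitsSimplyConnected` of line `pair-rigidity-retraction` — crux
`CongruenceShadows.HeegaardHandlebodyCongruenceClosed` (item stmt-SmoothPoincare4-14596)

Landed form (lead): the OPEN registered stub itself is NOT in this file (it stays open in the lead's skeleton); this file lands the
fully proved partial lemmas under the registered helper stub `stub_limitsSimplyConnectedDichotomy`.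
ORIGINALLY: WORK FILE (stub-worker).  The registered stub (genera `≥ 6`) is OPEN; it was kept in the worker's copy unproved
(NOT proposed).  Sorry-free partial results `p3_*` proved below, in the notation
`S = S_{3+3m}`, `N = (N₀,N₁,N₂) = s4Kernels.stabilizeIter m`, `H = Stab N₀ ∩ Stab N₁`, `C = Stab N₂`,
`T_ρ = N₀ ⊔ N₁ ⊔ ρN₂`, `G_ρ = S ⧸ T_ρ`, "product-congruent" = the crux hypothesis:

* `p3_tripleJoin_eq_top_of_finiteIndex` — if `G_ρ` is finite (`T_ρ` of finite index) then `G_ρ = 1`.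
* `p3_dichotomy` — either `T_ρ = ⊤`, or `G_ρ` is infinite and every homomorphism `S → Q` (finite `Q`)
  killing `T_ρ` is trivial: a counterexample is an INFINITE group with no non-trivial finite quotient.
* `p3_tripleJoin_eq_top_of_frozenLeft` — if ONE `x ∈ H` serves at every level (`ρ ≡ x ∘ c_M (mod M)`,
  `c_M ∈ C`), then `T_ρ = ⊤`, granted that `N₂` is closed in the characteristic profinite topology of `S`
  (= residual finiteness of `S ⧸ N₂ ≅ F_{3+3m}` plus cofinality; taken as a hypothesis `hcl`).
* `p3_tripleJoin_eq_top_of_frozenRight` — symmetrically, if ONE `c ∈ C` serves at every level, then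
  `T_ρ = ⊤`, granted closedness of `N₀` and `N₁`.
So in a counterexample BOTH factors `x_M`, `c_M` must leave every finite set along the tower.
-/

noncomputable section

-- the prescribed namespace `Summit.<P>.<Sub>.…` duplicates `SmoothPoincare4` (P = Sub)
set_option linter.dupNamespace false

namespace Summit.SmoothPoincare4.SmoothPoincare4.Theorems.HeegaardHandlebodyCongruenceClosed.PairRigidityRetraction

open Literature.Topology.FourManifolds Subgroup

/-! ## Finite `G_ρ` collapses; the dichotomy -/

/-- **Finite limits are simply connected.** For a product-congruent `ρ`, if `T_ρ = N₀ ⊔ N₁ ⊔ ρN₂` has finite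
index (i.e. `G_ρ` is finite) then `T_ρ = ⊤`: `T_ρ` contains a characteristic finite-index `M`
(cofinality) and `T_ρ ⊔ M = ⊤` (level collapse). [folklore] -/
theorem p3_tripleJoin_eq_top_of_finiteIndex {m : ℕ}
    {ρ : SurfaceGroup (3 + 3 * m) ≃* SurfaceGroup (3 + 3 * m)}
    (h : ∀ M : Subgroup (SurfaceGroup (3 + 3 * m)), M.Characteristic → M.FiniteIndex →
      ∃ x c : SurfaceGroup (3 + 3 * m) ≃* SurfaceGroup (3 + 3 * m),
        (s4Kernels.stabilizeIter m 0).map x.toMonoidHom = s4Kernels.stabilizeIter m 0 ∧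
        (s4Kernels.stabilizeIter m 1).map x.toMonoidHom = s4Kernels.stabilizeIter m 1 ∧
        (s4Kernels.stabilizeIter m 2).map c.toMonoidHom = s4Kernels.stabilizeIter m 2 ∧
        ∀ s, ρ s * (x (c s))⁻¹ ∈ M)
    (hT : (s4Kernels.stabilizeIter m 0 ⊔ s4Kernels.stabilizeIter m 1 ⊔
      (s4Kernels.stabilizeIter m 2).map ρ.toMonoidHom).FiniteIndex) :
    s4Kernels.stabilizeIter m 0 ⊔ s4Kernels.stabilizeIter m 1 ⊔
      (s4Kernels.stabilizeIter m 2).map ρ.toMonoidHom = ⊤ := by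
  haveI := hT
  obtain ⟨M, hM, hF, hle⟩ := exists_characteristic_le
    (s4Kernels.stabilizeIter m 0 ⊔ s4Kernels.stabilizeIter m 1 ⊔ (s4Kernels.stabilizeIter m 2).map ρ.toMonoidHom)
  have htop := tripleJoin_sup_eq_top_of_productCongruent h M hM hF
  rwa [sup_eq_left.2 hle] at htop

/-- **Dichotomy.** For a product-congruent `ρ`: either `T_ρ = ⊤` (`G_ρ = 1`), or `G_ρ = S ⧸ T_ρ` is infinite
and every homomorphism from `S` to a finite group that kills `T_ρ` is trivial (so `G_ρ` is an infinite,
finitely presented group without non-trivial finite quotients). [folklore] -/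
theorem p3_dichotomy {m : ℕ}
    {ρ : SurfaceGroup (3 + 3 * m) ≃* SurfaceGroup (3 + 3 * m)}
    (h : ∀ M : Subgroup (SurfaceGroup (3 + 3 * m)), M.Characteristic → M.FiniteIndex →
      ∃ x c : SurfaceGroup (3 + 3 * m) ≃* SurfaceGroup (3 + 3 * m),
        (s4Kernels.stabilizeIter m 0).map x.toMonoidHom = s4Kernels.stabilizeIter m 0 ∧
        (s4Kernels.stabilizeIter m 1).map x.toMonoidHom = s4Kernels.stabilizeIter m 1 ∧
        (s4Kernels.stabilizeIter m 2).map c.toMonoidHom = s4Kernels.stabilizeIter m 2 ∧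
        ∀ s, ρ s * (x (c s))⁻¹ ∈ M) :
    s4Kernels.stabilizeIter m 0 ⊔ s4Kernels.stabilizeIter m 1 ⊔
        (s4Kernels.stabilizeIter m 2).map ρ.toMonoidHom = ⊤ ∨
      (Infinite (SurfaceGroup (3 + 3 * m) ⧸ (s4Kernels.stabilizeIter m 0 ⊔ s4Kernels.stabilizeIter m 1 ⊔
          (s4Kernels.stabilizeIter m 2).map ρ.toMonoidHom)) ∧
        ∀ (Q : Type) [Group Q] [Finite Q] (f : SurfaceGroup (3 + 3 * m) →* Q),
          s4Kernels.stabilizeIter m 0 ⊔ s4Kernels.stabilizeIter m 1 ⊔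
              (s4Kernels.stabilizeIter m 2).map ρ.toMonoidHom ≤ f.ker →
            ∀ s, f s = 1) := by
  by_cases htop : s4Kernels.stabilizeIter m 0 ⊔ s4Kernels.stabilizeIter m 1 ⊔
      (s4Kernels.stabilizeIter m 2).map ρ.toMonoidHom = ⊤
  · exact Or.inl htop
  · refine Or.inr ⟨?_, fun Q _ _ f hf s => hom_trivial_of_productCongruent h f hf s⟩
    rw [← not_finite_iff_infinite]
    intro hfin
    haveI : (s4Kernels.stabilizeIter m 0 ⊔ s4Kernels.stabilizeIter m 1 ⊔
        (s4Kernels.stabilizeIter m 2).map ρ.toMonoidHom).FiniteIndex := Subgroup.finiteIndex_of_finite_quotient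
    exact htop (p3_tripleJoin_eq_top_of_finiteIndex h inferInstance)

/-! ## Freezing one factor along the tower collapses `G_ρ` -/

/-- **Frozen `H`-factor.** If one `x ∈ Stab N₀ ∩ Stab N₁` serves at every characteristic finite-index level
(`ρ ≡ x ∘ c_M (mod M)` with `c_M ∈ Stab N₂`), then `N₀ ⊔ N₁ ⊔ ρN₂ = ⊤` — granted that `N₂` is closed in the
characteristic profinite topology of `S` (hypothesis `hcl`; residual finiteness of `S ⧸ N₂ ≅ F_{3+3m}`).
Proof: `xN₂ ≤ ρN₂` (for `t ∈ N₂`, `ρ⁻¹(x t) ∈ N₂ ⊔ M` for all `M`), so `T_ρ ⊇ x(N₀ ⊔ N₁ ⊔ N₂) = ⊤`. [folklore] -/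
theorem p3_tripleJoin_eq_top_of_frozenLeft {m : ℕ}
    {ρ : SurfaceGroup (3 + 3 * m) ≃* SurfaceGroup (3 + 3 * m)}
    (hcl : ∀ s : SurfaceGroup (3 + 3 * m),
      (∀ M : Subgroup (SurfaceGroup (3 + 3 * m)), M.Characteristic → M.FiniteIndex →
        s ∈ s4Kernels.stabilizeIter m 2 ⊔ M) → s ∈ s4Kernels.stabilizeIter m 2)
    (x : SurfaceGroup (3 + 3 * m) ≃* SurfaceGroup (3 + 3 * m))
    (hx0 : (s4Kernels.stabilizeIter m 0).map x.toMonoidHom = s4Kernels.stabilizeIter m 0)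
    (hx1 : (s4Kernels.stabilizeIter m 1).map x.toMonoidHom = s4Kernels.stabilizeIter m 1)
    (h : ∀ M : Subgroup (SurfaceGroup (3 + 3 * m)), M.Characteristic → M.FiniteIndex →
      ∃ c : SurfaceGroup (3 + 3 * m) ≃* SurfaceGroup (3 + 3 * m),
        (s4Kernels.stabilizeIter m 2).map c.toMonoidHom = s4Kernels.stabilizeIter m 2 ∧
        ∀ s, ρ s * (x (c s))⁻¹ ∈ M) :
    s4Kernels.stabilizeIter m 0 ⊔ s4Kernels.stabilizeIter m 1 ⊔
      (s4Kernels.stabilizeIter m 2).map ρ.toMonoidHom = ⊤ := by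
  -- `x N₂ ≤ ρ N₂`
  have hx2 : (s4Kernels.stabilizeIter m 2).map x.toMonoidHom ≤ (s4Kernels.stabilizeIter m 2).map ρ.toMonoidHom := by
    rintro _ ⟨t, ht, rfl⟩
    refine ⟨ρ.symm (x t), hcl _ fun M hM hF => ?_, by simp⟩
    obtain ⟨c, hc, hs⟩ := h M hM hF
    haveI := hM
    -- `c⁻¹ t ∈ N₂`
    have hct : c.symm t ∈ s4Kernels.stabilizeIter m 2 := by
      have : t ∈ (s4Kernels.stabilizeIter m 2).map c.toMonoidHom := hc.symm ▸ ht
      obtain ⟨t', ht', rfl⟩ := this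
      simpa using ht'
    have hm : ρ (c.symm t) * (x t)⁻¹ ∈ M := by simpa using hs (c.symm t)
    have hm' : ρ.symm ((ρ (c.symm t) * (x t)⁻¹)⁻¹) ∈ M := by
      have := (Subgroup.characteristic_iff_map_eq.mp hM) ρ.symm
      rw [← this]
      exact ⟨_, inv_mem hm, rfl⟩
    have key : ρ.symm (x t) = ρ.symm ((ρ (c.symm t) * (x t)⁻¹)⁻¹) * c.symm t := by
      apply ρ.injective
      simp [map_mul, mul_inv_rev]
    rw [key]
    exact mul_mem (mem_sup_right hm') (mem_sup_left hct)
  -- hence `T_ρ ⊇ x(N₀ ⊔ N₁ ⊔ N₂) = ⊤`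
  rw [eq_top_iff]
  calc (⊤ : Subgroup (SurfaceGroup (3 + 3 * m)))
      = (⊤ : Subgroup (SurfaceGroup (3 + 3 * m))).map x.toMonoidHom := by
        rw [← MonoidHom.range_eq_map, MonoidHom.range_eq_top.2 x.surjective]
    _ = (s4Kernels.stabilizeIter m 0 ⊔ s4Kernels.stabilizeIter m 1 ⊔ s4Kernels.stabilizeIter m 2).map
          x.toMonoidHom := by rw [sup_stabilizeIter_eq_top m]
    _ = s4Kernels.stabilizeIter m 0 ⊔ s4Kernels.stabilizeIter m 1 ⊔
          (s4Kernels.stabilizeIter m 2).map x.toMonoidHom := by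
        rw [Subgroup.map_sup, Subgroup.map_sup, hx0, hx1]
    _ ≤ _ := sup_le_sup_left hx2 _

/-- **Frozen `C`-factor.** If one `c ∈ Stab N₂` serves at every characteristic finite-index level
(`ρ ≡ x_M ∘ c (mod M)` with `x_M ∈ Stab N₀ ∩ Stab N₁`), then `N₀ ⊔ N₁ ⊔ ρN₂ = ⊤` — granted that `N₀` and `N₁`
are closed in the characteristic profinite topology of `S` (hypotheses `hcl0`, `hcl1`; residual finiteness of
`S ⧸ N_i ≅ F_{3+3m}`).  Proof: `ρ' := ρ ∘ c⁻¹` has `ρ'N₂ = ρN₂` and `ρ'N_i ≤ N_i` (`i = 0,1`), so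
`T_ρ ⊇ ρ'(N₀ ⊔ N₁ ⊔ N₂) = ⊤`. [folklore] -/
theorem p3_tripleJoin_eq_top_of_frozenRight {m : ℕ}
    {ρ : SurfaceGroup (3 + 3 * m) ≃* SurfaceGroup (3 + 3 * m)}
    (hcl0 : ∀ s : SurfaceGroup (3 + 3 * m),
      (∀ M : Subgroup (SurfaceGroup (3 + 3 * m)), M.Characteristic → M.FiniteIndex →
        s ∈ s4Kernels.stabilizeIter m 0 ⊔ M) → s ∈ s4Kernels.stabilizeIter m 0)
    (hcl1 : ∀ s : SurfaceGroup (3 + 3 * m),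
      (∀ M : Subgroup (SurfaceGroup (3 + 3 * m)), M.Characteristic → M.FiniteIndex →
        s ∈ s4Kernels.stabilizeIter m 1 ⊔ M) → s ∈ s4Kernels.stabilizeIter m 1)
    (c : SurfaceGroup (3 + 3 * m) ≃* SurfaceGroup (3 + 3 * m))
    (hc : (s4Kernels.stabilizeIter m 2).map c.toMonoidHom = s4Kernels.stabilizeIter m 2)
    (h : ∀ M : Subgroup (SurfaceGroup (3 + 3 * m)), M.Characteristic → M.FiniteIndex →
      ∃ x : SurfaceGroup (3 + 3 * m) ≃* SurfaceGroup (3 + 3 * m),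
        (s4Kernels.stabilizeIter m 0).map x.toMonoidHom = s4Kernels.stabilizeIter m 0 ∧
        (s4Kernels.stabilizeIter m 1).map x.toMonoidHom = s4Kernels.stabilizeIter m 1 ∧
        ∀ s, ρ s * (x (c s))⁻¹ ∈ M) :
    s4Kernels.stabilizeIter m 0 ⊔ s4Kernels.stabilizeIter m 1 ⊔
      (s4Kernels.stabilizeIter m 2).map ρ.toMonoidHom = ⊤ := by
  set ρ' : SurfaceGroup (3 + 3 * m) ≃* SurfaceGroup (3 + 3 * m) := c.symm.trans ρ with hρ'
  -- `ρ' N_i ≤ N_i` for `i = 0, 1`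
  have hsub : ∀ (i : Fin 3) (Ni : Subgroup (SurfaceGroup (3 + 3 * m))),
      (∀ s : SurfaceGroup (3 + 3 * m),
        (∀ M : Subgroup (SurfaceGroup (3 + 3 * m)), M.Characteristic → M.FiniteIndex → s ∈ Ni ⊔ M) → s ∈ Ni) →
      (∀ M : Subgroup (SurfaceGroup (3 + 3 * m)), M.Characteristic → M.FiniteIndex →
        ∃ x : SurfaceGroup (3 + 3 * m) ≃* SurfaceGroup (3 + 3 * m),
          Ni.map x.toMonoidHom = Ni ∧ ∀ s, ρ s * (x (c s))⁻¹ ∈ M) →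
      Ni.map ρ'.toMonoidHom ≤ Ni := by
    intro i Ni hclN hN
    rintro _ ⟨t, ht, rfl⟩
    refine hclN _ fun M hM hF => ?_
    obtain ⟨x, hx, hs⟩ := hN M hM hF
    have hm : ρ (c.symm t) * (x t)⁻¹ ∈ M := by simpa using hs (c.symm t)
    have key : ρ' t = (ρ (c.symm t) * (x t)⁻¹) * x t := by simp [hρ']
    rw [MulEquiv.coe_toMonoidHom, key]
    exact mul_mem (mem_sup_right hm) (mem_sup_left (hx.le ⟨t, ht, rfl⟩))
  have h0 : (s4Kernels.stabilizeIter m 0).map ρ'.toMonoidHom ≤ s4Kernels.stabilizeIter m 0 :=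
    hsub 0 _ hcl0 fun M hM hF => by
      obtain ⟨x, hx0, -, hs⟩ := h M hM hF
      exact ⟨x, hx0, hs⟩
  have h1 : (s4Kernels.stabilizeIter m 1).map ρ'.toMonoidHom ≤ s4Kernels.stabilizeIter m 1 :=
    hsub 1 _ hcl1 fun M hM hF => by
      obtain ⟨x, -, hx1, hs⟩ := h M hM hF
      exact ⟨x, hx1, hs⟩
  -- `ρ' N₂ = ρ N₂`
  have h2 : (s4Kernels.stabilizeIter m 2).map ρ'.toMonoidHom ≤ (s4Kernels.stabilizeIter m 2).map ρ.toMonoidHom := by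
    rintro _ ⟨t, ht, rfl⟩
    have hct : c.symm t ∈ s4Kernels.stabilizeIter m 2 := by
      have : t ∈ (s4Kernels.stabilizeIter m 2).map c.toMonoidHom := hc.symm ▸ ht
      obtain ⟨t', ht', rfl⟩ := this
      simpa using ht'
    exact ⟨c.symm t, hct, by simp [hρ']⟩
  rw [eq_top_iff]
  calc (⊤ : Subgroup (SurfaceGroup (3 + 3 * m)))
      = (⊤ : Subgroup (SurfaceGroup (3 + 3 * m))).map ρ'.toMonoidHom := by
        rw [← MonoidHom.range_eq_map, MonoidHom.range_eq_top.2 ρ'.surjective]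
    _ = (s4Kernels.stabilizeIter m 0 ⊔ s4Kernels.stabilizeIter m 1 ⊔ s4Kernels.stabilizeIter m 2).map
          ρ'.toMonoidHom := by rw [sup_stabilizeIter_eq_top m]
    _ = (s4Kernels.stabilizeIter m 0).map ρ'.toMonoidHom ⊔ (s4Kernels.stabilizeIter m 1).map ρ'.toMonoidHom ⊔
          (s4Kernels.stabilizeIter m 2).map ρ'.toMonoidHom := by
        rw [Subgroup.map_sup, Subgroup.map_sup]
    _ ≤ _ := sup_le_sup (sup_le_sup h0 h1) h2

/-! ## Pigeonhole: finitely many candidate factors already collapse `G_ρ` -/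

/-- An intersection of characteristic subgroups is characteristic. [folklore] -/
theorem p3_characteristic_iInf {G : Type*} [Group G] {ι : Sort*} {M : ι → Subgroup G}
    (hM : ∀ i, (M i).Characteristic) : (⨅ i, M i).Characteristic := by
  rw [Subgroup.characteristic_iff_comap_eq]
  intro φ
  rw [Subgroup.comap_iInf]
  exact iInf_congr fun i => (Subgroup.characteristic_iff_comap_eq.mp (hM i)) φ

/-- **Finitely many `H`-factors.** If the `H`-factors `x_M` of a product-congruent `ρ` can be drawn from a FINITE
family, then `N₀ ⊔ N₁ ⊔ ρN₂ = ⊤` (granted closedness of `N₂`): by pigeonhole over the intersection of the bad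
levels one member of the family serves at every level, and `p3_tripleJoin_eq_top_of_frozenLeft` applies.  So in a
counterexample the `x_M` leave every finite subset of `Stab N₀ ∩ Stab N₁` along the tower. [folklore] -/
theorem p3_tripleJoin_eq_top_of_finiteLeft {m : ℕ}
    {ρ : SurfaceGroup (3 + 3 * m) ≃* SurfaceGroup (3 + 3 * m)}
    (hcl : ∀ s : SurfaceGroup (3 + 3 * m),
      (∀ M : Subgroup (SurfaceGroup (3 + 3 * m)), M.Characteristic → M.FiniteIndex →
        s ∈ s4Kernels.stabilizeIter m 2 ⊔ M) → s ∈ s4Kernels.stabilizeIter m 2)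
    {ι : Type*} [Finite ι] (xs : ι → SurfaceGroup (3 + 3 * m) ≃* SurfaceGroup (3 + 3 * m))
    (hx0 : ∀ i, (s4Kernels.stabilizeIter m 0).map (xs i).toMonoidHom = s4Kernels.stabilizeIter m 0)
    (hx1 : ∀ i, (s4Kernels.stabilizeIter m 1).map (xs i).toMonoidHom = s4Kernels.stabilizeIter m 1)
    (h : ∀ M : Subgroup (SurfaceGroup (3 + 3 * m)), M.Characteristic → M.FiniteIndex →
      ∃ i, ∃ c : SurfaceGroup (3 + 3 * m) ≃* SurfaceGroup (3 + 3 * m),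
        (s4Kernels.stabilizeIter m 2).map c.toMonoidHom = s4Kernels.stabilizeIter m 2 ∧
        ∀ s, ρ s * (xs i (c s))⁻¹ ∈ M) :
    s4Kernels.stabilizeIter m 0 ⊔ s4Kernels.stabilizeIter m 1 ⊔
      (s4Kernels.stabilizeIter m 2).map ρ.toMonoidHom = ⊤ := by
  by_cases hex : ∃ i, ∀ M : Subgroup (SurfaceGroup (3 + 3 * m)), M.Characteristic → M.FiniteIndex →
      ∃ c : SurfaceGroup (3 + 3 * m) ≃* SurfaceGroup (3 + 3 * m),
        (s4Kernels.stabilizeIter m 2).map c.toMonoidHom = s4Kernels.stabilizeIter m 2 ∧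
        ∀ s, ρ s * (xs i (c s))⁻¹ ∈ M
  · obtain ⟨i, hi⟩ := hex
    exact p3_tripleJoin_eq_top_of_frozenLeft hcl (xs i) (hx0 i) (hx1 i) hi
  · push Not at hex
    choose M hMc hMf hbad using hex
    obtain ⟨i, c, hc, hs⟩ := h (⨅ i, M i) (p3_characteristic_iInf hMc) (Subgroup.finiteIndex_iInf hMf)
    obtain ⟨s, hs'⟩ := hbad i c hc
    exact (hs' (Subgroup.mem_iInf.1 (hs s) i)).elim

/-- **Finitely many `C`-factors.** Symmetrically: if the `C`-factors `c_M` can be drawn from a finite family, then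
`N₀ ⊔ N₁ ⊔ ρN₂ = ⊤` (granted closedness of `N₀`, `N₁`). [folklore] -/
theorem p3_tripleJoin_eq_top_of_finiteRight {m : ℕ}
    {ρ : SurfaceGroup (3 + 3 * m) ≃* SurfaceGroup (3 + 3 * m)}
    (hcl0 : ∀ s : SurfaceGroup (3 + 3 * m),
      (∀ M : Subgroup (SurfaceGroup (3 + 3 * m)), M.Characteristic → M.FiniteIndex →
        s ∈ s4Kernels.stabilizeIter m 0 ⊔ M) → s ∈ s4Kernels.stabilizeIter m 0)
    (hcl1 : ∀ s : SurfaceGroup (3 + 3 * m),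
      (∀ M : Subgroup (SurfaceGroup (3 + 3 * m)), M.Characteristic → M.FiniteIndex →
        s ∈ s4Kernels.stabilizeIter m 1 ⊔ M) → s ∈ s4Kernels.stabilizeIter m 1)
    {ι : Type*} [Finite ι] (cs : ι → SurfaceGroup (3 + 3 * m) ≃* SurfaceGroup (3 + 3 * m))
    (hc : ∀ i, (s4Kernels.stabilizeIter m 2).map (cs i).toMonoidHom = s4Kernels.stabilizeIter m 2)
    (h : ∀ M : Subgroup (SurfaceGroup (3 + 3 * m)), M.Characteristic → M.FiniteIndex →
      ∃ i, ∃ x : SurfaceGroup (3 + 3 * m) ≃* SurfaceGroup (3 + 3 * m),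
        (s4Kernels.stabilizeIter m 0).map x.toMonoidHom = s4Kernels.stabilizeIter m 0 ∧
        (s4Kernels.stabilizeIter m 1).map x.toMonoidHom = s4Kernels.stabilizeIter m 1 ∧
        ∀ s, ρ s * (x (cs i s))⁻¹ ∈ M) :
    s4Kernels.stabilizeIter m 0 ⊔ s4Kernels.stabilizeIter m 1 ⊔
      (s4Kernels.stabilizeIter m 2).map ρ.toMonoidHom = ⊤ := by
  by_cases hex : ∃ i, ∀ M : Subgroup (SurfaceGroup (3 + 3 * m)), M.Characteristic → M.FiniteIndex →
      ∃ x : SurfaceGroup (3 + 3 * m) ≃* SurfaceGroup (3 + 3 * m),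
        (s4Kernels.stabilizeIter m 0).map x.toMonoidHom = s4Kernels.stabilizeIter m 0 ∧
        (s4Kernels.stabilizeIter m 1).map x.toMonoidHom = s4Kernels.stabilizeIter m 1 ∧
        ∀ s, ρ s * (x (cs i s))⁻¹ ∈ M
  · obtain ⟨i, hi⟩ := hex
    exact p3_tripleJoin_eq_top_of_frozenRight hcl0 hcl1 (cs i) (hc i) hi
  · push Not at hex
    choose M hMc hMf hbad using hex
    obtain ⟨i, x, hx0, hx1, hs⟩ := h (⨅ i, M i) (p3_characteristic_iInf hMc) (Subgroup.finiteIndex_iInf hMf)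
    obtain ⟨s, hs'⟩ := hbad i x hx0 hx1
    exact (hs' (Subgroup.mem_iInf.1 (hs s) i)).elim

/-! ## Registered helper stub: the dichotomy for fine-closure ghosts (landed rider for the OPEN stub P3) -/

/-- **Registered stub `stub_limitsSimplyConnectedDichotomy` of line `pair-rigidity-retraction`** (helper toward
the OPEN stub P3 `stub_limitsSimplyConnected`, signature verbatim as registered on stmt-SmoothPoincare4-14596):
for a product-congruent `ρ` at ANY genus `3+3m`, either the glued group `G_ρ = S ⧸ (N₀ ⊔ N₁ ⊔ ρN₂)` is trivial,
or it is INFINITE and every homomorphism from `S` to a finite group killing `N₀ ⊔ N₁ ⊔ ρN₂` is trivial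
(a "ghost": non-trivial, perfect, no finite quotient).  `= p3_dichotomy`. [folklore] -/
theorem stub_limitsSimplyConnectedDichotomy :
    ∀ (m : ℕ) (ρ : SurfaceGroup (3 + 3 * m) ≃* SurfaceGroup (3 + 3 * m)),
      (∀ M : Subgroup (SurfaceGroup (3 + 3 * m)), M.Characteristic → M.FiniteIndex →
        ∃ x c : SurfaceGroup (3 + 3 * m) ≃* SurfaceGroup (3 + 3 * m),
          (s4Kernels.stabilizeIter m 0).map x.toMonoidHom = s4Kernels.stabilizeIter m 0 ∧
          (s4Kernels.stabilizeIter m 1).map x.toMonoidHom = s4Kernels.stabilizeIter m 1 ∧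
          (s4Kernels.stabilizeIter m 2).map c.toMonoidHom = s4Kernels.stabilizeIter m 2 ∧
          ∀ s, ρ s * (x (c s))⁻¹ ∈ M) →
      s4Kernels.stabilizeIter m 0 ⊔ s4Kernels.stabilizeIter m 1 ⊔
          (s4Kernels.stabilizeIter m 2).map ρ.toMonoidHom = ⊤ ∨
        (Infinite (SurfaceGroup (3 + 3 * m) ⧸ (s4Kernels.stabilizeIter m 0 ⊔ s4Kernels.stabilizeIter m 1 ⊔
            (s4Kernels.stabilizeIter m 2).map ρ.toMonoidHom)) ∧
          ∀ (Q : Type) [Group Q] [Finite Q] (f : SurfaceGroup (3 + 3 * m) →* Q),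
            s4Kernels.stabilizeIter m 0 ⊔ s4Kernels.stabilizeIter m 1 ⊔
                (s4Kernels.stabilizeIter m 2).map ρ.toMonoidHom ≤ f.ker →
              ∀ s, f s = 1) :=
  fun _ _ h => p3_dichotomy h

end Summit.SmoothPoincare4.SmoothPoincare4.Theorems.HeegaardHandlebodyCongruenceClosed.PairRigidityRetraction

end
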